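import Mathlib.Algebra.BigOperators.Group.Finset.Powerset
import Summits.CriticalPhenomena.PercolationContinuityZ3.Theorems.PercNearOneGluingNoHeavyLowerTailKnQuestion8CoefficientwiseOffClusterTwo
import Summits.CriticalPhenomena.PercolationContinuityZ3.Theorems.PercNearOneGluingNoHeavyLowerTailKnQuestion8CoefficientwisePendant
import HarnessLib

/-!
# Gluing API for the coefficientwise first rung: clusters of a multigraph glued from two pieces at one or two vertices

Support file (`--supports stmt-CriticalPhenomena-4575`, closed), prover `prim-lf-2` (gen 26).  No definitions, no named facts, no sorries; standard axioms.
Memo `prim-lf-2/CW-MARTINGALE-gen25.md` §8 (THEOREM SP: the class `𝒞` of rooted multigraphs `(G; x, z)` satisfying the coefficientwise first rung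
`Σ_{no monochromatic x–z path} (f(K) − f(K̄))(g(K) − g(K̄)) ≥ 0` is closed under series composition, parallel composition and hanging decorations).
This file supplies the deterministic bookkeeping used by the Lean versions of those closure theorems (companion files `…CoefficientwiseSeries.lean`,
`…CoefficientwiseDecoration.lean`):

Setting: a finite multigraph `ends : ι → Sym2 V`, a colouring `s : Finset ι` (the red edges), `C_a(s) := openCluster (ends '' s) a` the red vertex cluster of `a`.
* `exists_edge_of_mem_openCluster` — a vertex `≠ a` of `C_a(s)` meets an edge of `s`.
* `mem_openCluster_union_glue` — **gluing at one vertex**: if the edges of `s₁` and of `s₂` can only share the vertex `v`, and `x` meets `s₂` only at `v`, then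
  `C_x(s₁ ∪ s₂) = C_x(s₁) ∪ [v ∈ C_x(s₁)]·C_v(s₂)`.
* `mem_openCluster_union_parallel` — **gluing at two vertices**: if the edges of `s₁`, `s₂` can only share `x, z` and `z ∉ C_x(s₁) ∪ C_x(s₂)`, then
  `C_x(s₁ ∪ s₂) = C_x(s₁) ∪ C_x(s₂)`.
* `sum_powerset_sdiff`, `fkg_powerset` — colour-swap reindexing and FKG (counting weight) on the colourings `E.powerset` of an edge set `E`.
* `offCluster_twoColouring_nonneg₂_sub` — the two-function off-cluster lemma (`…OffClusterTwo`) on a sub-multigraph `E' ⊆ ι`.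
[cite: KozmaNitzan2024, Questions 8–9 (§5.5 p. 36) (context: first rung of the coefficientwise programme for Question 8)]
-/

namespace Summit.CriticalPhenomena.PercolationContinuityZ3.Theorems

open Finset Literature.Probability.Percolation

namespace Coefficientwise

variable {ι V : Type*}

/-- A vertex of the red cluster of `a` other than `a` itself meets a red edge. [cite: KozmaNitzan2024, §5.5 (context only; folklore)] -/
theorem exists_edge_of_mem_openCluster (ends : ι → Sym2 V) {s : Finset ι} {a y : V}
    (hy : y ∈ openCluster (ends '' (↑s : Set ι)) a) (hya : y ≠ a) : ∃ e ∈ s, y ∈ ends e := by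
  change (openGraph (ends '' (↑s : Set ι))).Reachable a y at hy
  rw [SimpleGraph.reachable_iff_reflTransGen] at hy
  induction hy with
  | refl => exact absurd rfl hya
  | @tail b c _ hbc _ =>
    rw [openGraph_image_adj] at hbc
    obtain ⟨⟨i, his, hi⟩, _⟩ := hbc
    exact ⟨i, his, by rw [hi]; exact Sym2.mem_mk_right b c⟩

/-- Adjacency by a red edge of `s ⊆ t` is adjacency in the red graph of `t`. [cite: KozmaNitzan2024, §5.5 (context only; folklore)] -/
theorem openGraph_image_adj_mono (ends : ι → Sym2 V) {s t : Finset ι} (hst : s ⊆ t) {u w : V}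
    (h : (openGraph (ends '' (↑s : Set ι))).Adj u w) : (openGraph (ends '' (↑t : Set ι))).Adj u w := by
  rw [openGraph_image_adj] at h ⊢
  obtain ⟨⟨i, his, hi⟩, hne⟩ := h
  exact ⟨⟨i, hst his, hi⟩, hne⟩

/-- **Gluing at one vertex.**  If every edge of `s₁` and every edge of `s₂` can only share the vertex `v`, and `x` lies on an edge of `s₂` only if
`x = v`, then the red cluster of `x` for `s₁ ∪ s₂` is `C_x(s₁)`, enlarged by `C_v(s₂)` when `v ∈ C_x(s₁)` (series composition through the cut vertex
`v`, or a decoration hung at `v`).  [cite: KozmaNitzan2024, §5.5 (context only; folklore)] -/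
theorem mem_openCluster_union_glue [DecidableEq ι] (ends : ι → Sym2 V) {s₁ s₂ : Finset ι} {v x : V}
    (hsep : ∀ e ∈ s₁, ∀ e' ∈ s₂, ∀ w : V, w ∈ ends e → w ∈ ends e' → w = v)
    (hx : ∀ e ∈ s₂, x ∈ ends e → x = v) (y : V) :
    y ∈ openCluster (ends '' (↑(s₁ ∪ s₂) : Set ι)) x ↔
      y ∈ openCluster (ends '' (↑s₁ : Set ι)) x ∨
        (v ∈ openCluster (ends '' (↑s₁ : Set ι)) x ∧ y ∈ openCluster (ends '' (↑s₂ : Set ι)) v) := by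
  constructor
  · intro hy
    change (openGraph (ends '' (↑(s₁ ∪ s₂) : Set ι))).Reachable x y at hy
    rw [SimpleGraph.reachable_iff_reflTransGen] at hy
    induction hy with
    | refl => exact Or.inl (mem_openCluster_self _ x)
    | @tail b c _ hbc ih =>
      have hbc' := hbc
      rw [openGraph_image_adj] at hbc'
      obtain ⟨⟨i, hi12, hi⟩, hne⟩ := hbc'
      have hbi : b ∈ ends i := by rw [hi]; exact Sym2.mem_mk_left b c
      rcases Finset.mem_union.mp hi12 with hi1 | hi2
      · -- the step uses an edge of `s₁`
        have hadj1 : (openGraph (ends '' (↑s₁ : Set ι))).Adj b c := by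
          rw [openGraph_image_adj]; exact ⟨⟨i, hi1, hi⟩, hne⟩
        rcases ih with hb | ⟨hv, hb⟩
        · exact Or.inl (SimpleGraph.Reachable.trans hb hadj1.reachable)
        · by_cases hbv : b = v
          · subst hbv
            exact Or.inl (SimpleGraph.Reachable.trans hv hadj1.reachable)
          · obtain ⟨e', he', hbe'⟩ := exists_edge_of_mem_openCluster ends hb hbv
            exact absurd (hsep i hi1 e' he' b hbi hbe') hbv
      · -- the step uses an edge of `s₂`
        have hadj2 : (openGraph (ends '' (↑s₂ : Set ι))).Adj b c := by
          rw [openGraph_image_adj]; exact ⟨⟨i, hi2, hi⟩, hne⟩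
        rcases ih with hb | ⟨hv, hb⟩
        · by_cases hbx : b = x
          · subst hbx
            have hbv : b = v := hx i hi2 hbi
            subst hbv
            exact Or.inr ⟨mem_openCluster_self _ b, hadj2.reachable⟩
          · obtain ⟨e, he, hbe⟩ := exists_edge_of_mem_openCluster ends hb hbx
            have hbv : b = v := hsep e he i hi2 b hbe hbi
            subst hbv
            exact Or.inr ⟨hb, hadj2.reachable⟩
        · exact Or.inr ⟨hv, SimpleGraph.Reachable.trans hb hadj2.reachable⟩
  · rintro (hy | ⟨hv, hy⟩)
    · exact openCluster_image_mono ends Finset.subset_union_left x hy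
    · have hv' : v ∈ openCluster (ends '' (↑(s₁ ∪ s₂) : Set ι)) x :=
        openCluster_image_mono ends Finset.subset_union_left x hv
      have hy' : y ∈ openCluster (ends '' (↑(s₁ ∪ s₂) : Set ι)) v :=
        openCluster_image_mono ends Finset.subset_union_right v hy
      exact SimpleGraph.Reachable.trans hv' hy'

/-- **Gluing at two vertices (parallel composition).**  If every edge of `s₁` and every edge of `s₂` can only share the vertices `x, z`, and `z` is in
neither `C_x(s₁)` nor `C_x(s₂)`, then `C_x(s₁ ∪ s₂) = C_x(s₁) ∪ C_x(s₂)` (a red path cannot change sides except through `x` or `z`); in particular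
`z ∉ C_x(s₁ ∪ s₂)`.  (Cf. `CoefficientwiseNA.cl_subset_union_of_sep` of prim-cplus-coupling, stated for `Finset`-valued clusters.)
[cite: KozmaNitzan2024, §5.5 (context only; folklore)] -/
theorem mem_openCluster_union_parallel [DecidableEq ι] (ends : ι → Sym2 V) {s₁ s₂ : Finset ι} {x z : V}
    (hsep : ∀ e ∈ s₁, ∀ e' ∈ s₂, ∀ w : V, w ∈ ends e → w ∈ ends e' → w = x ∨ w = z)
    (h1 : z ∉ openCluster (ends '' (↑s₁ : Set ι)) x) (h2 : z ∉ openCluster (ends '' (↑s₂ : Set ι)) x) (y : V) :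
    y ∈ openCluster (ends '' (↑(s₁ ∪ s₂) : Set ι)) x ↔
      y ∈ openCluster (ends '' (↑s₁ : Set ι)) x ∨ y ∈ openCluster (ends '' (↑s₂ : Set ι)) x := by
  constructor
  · intro hy
    change (openGraph (ends '' (↑(s₁ ∪ s₂) : Set ι))).Reachable x y at hy
    rw [SimpleGraph.reachable_iff_reflTransGen] at hy
    induction hy with
    | refl => exact Or.inl (mem_openCluster_self _ x)
    | @tail b c _ hbc ih =>
      have hbc' := hbc
      rw [openGraph_image_adj] at hbc'
      obtain ⟨⟨i, hi12, hi⟩, hne⟩ := hbc'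
      have hbi : b ∈ ends i := by rw [hi]; exact Sym2.mem_mk_left b c
      rcases Finset.mem_union.mp hi12 with hi1 | hi2
      · have hadj1 : (openGraph (ends '' (↑s₁ : Set ι))).Adj b c := by
          rw [openGraph_image_adj]; exact ⟨⟨i, hi1, hi⟩, hne⟩
        rcases ih with hb | hb
        · exact Or.inl (SimpleGraph.Reachable.trans hb hadj1.reachable)
        · by_cases hbx : b = x
          · subst hbx
            exact Or.inl hadj1.reachable
          · obtain ⟨e', he', hbe'⟩ := exists_edge_of_mem_openCluster ends hb hbx
            rcases hsep i hi1 e' he' b hbi hbe' with hb' | hb'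
            · exact absurd hb' hbx
            · subst hb'; exact absurd hb h2
      · have hadj2 : (openGraph (ends '' (↑s₂ : Set ι))).Adj b c := by
          rw [openGraph_image_adj]; exact ⟨⟨i, hi2, hi⟩, hne⟩
        rcases ih with hb | hb
        · by_cases hbx : b = x
          · subst hbx
            exact Or.inr hadj2.reachable
          · obtain ⟨e, he, hbe⟩ := exists_edge_of_mem_openCluster ends hb hbx
            rcases hsep e he i hi2 b hbe hbi with hb' | hb'
            · exact absurd hb' hbx
            · subst hb'; exact absurd hb h1
        · exact Or.inr (SimpleGraph.Reachable.trans hb hadj2.reachable)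
  · rintro (hy | hy)
    · exact openCluster_image_mono ends Finset.subset_union_left x hy
    · exact openCluster_image_mono ends Finset.subset_union_right x hy

/-- A vertex that meets no edge of `s` and is not the root is outside the root's red cluster. [cite: KozmaNitzan2024, §5.5 (context only; folklore)] -/
theorem not_mem_openCluster_of_forall_not_mem (ends : ι → Sym2 V) {s : Finset ι} {a y : V}
    (hy : ∀ e ∈ s, y ∉ ends e) (hya : y ≠ a) : y ∉ openCluster (ends '' (↑s : Set ι)) a := by
  intro h
  obtain ⟨e, he, hye⟩ := exists_edge_of_mem_openCluster ends h hya
  exact hy e he hye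

section sums

variable [DecidableEq ι]

/-- Colour-swap reindexing on a sub-multigraph: `Σ_{t ⊆ E} H(E ∖ t) = Σ_{t ⊆ E} H(t)`. [cite: KozmaNitzan2024, §5.5 (context only; folklore)] -/
theorem sum_powerset_sdiff (E : Finset ι) (H : Finset ι → ℝ) :
    ∑ t ∈ E.powerset, H (E \ t) = ∑ t ∈ E.powerset, H t := by
  refine Finset.sum_bij' (fun t _ => E \ t) (fun t _ => E \ t) ?_ ?_ ?_ ?_ ?_
  · intro t _; exact Finset.mem_powerset.mpr Finset.sdiff_subset
  · intro t _; exact Finset.mem_powerset.mpr Finset.sdiff_subset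
  · intro t ht; exact Finset.sdiff_sdiff_eq_self (Finset.mem_powerset.mp ht)
  · intro t ht; exact Finset.sdiff_sdiff_eq_self (Finset.mem_powerset.mp ht)
  · intro t _; rfl

/-- The complement inside a disjoint union splits: `(E₁ ∪ E₂) ∖ (t₁ ∪ t₂) = (E₁ ∖ t₁) ∪ (E₂ ∖ t₂)` for `tᵢ ⊆ Eᵢ`, `E₁ ∩ E₂ = ∅`.
[cite: KozmaNitzan2024, §5.5 (context only; folklore)] -/
theorem union_sdiff_union_of_subset {E₁ E₂ t₁ t₂ : Finset ι} (hE : Disjoint E₁ E₂) (h₁ : t₁ ⊆ E₁) (h₂ : t₂ ⊆ E₂) :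
    (E₁ ∪ E₂) \ (t₁ ∪ t₂) = (E₁ \ t₁) ∪ (E₂ \ t₂) := by
  ext i
  simp only [Finset.mem_sdiff, Finset.mem_union, not_or]
  constructor
  · rintro ⟨hi | hi, hn1, hn2⟩
    · exact Or.inl ⟨hi, hn1⟩
    · exact Or.inr ⟨hi, hn2⟩
  · rintro (⟨hi, hn⟩ | ⟨hi, hn⟩)
    · exact ⟨Or.inl hi, hn, fun h => Finset.disjoint_left.mp hE hi (h₂ h)⟩
    · exact ⟨Or.inr hi, fun h => Finset.disjoint_left.mp hE (h₁ h) hi, hn⟩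

variable [Fintype ι]

/-- FKG with the counting weight on the colourings of an edge set `E`: for monotone `Φ, Ψ : Finset ι → ℝ` (any sign),
`(Σ_{t ⊆ E} Φ)(Σ_{t ⊆ E} Ψ) ≤ 2^{|E|} · Σ_{t ⊆ E} Φ Ψ`.  (`fkg_cell` for the cell `{t | t ∩ Eᶜ = ∅} = E.powerset`.)
[cite: KozmaNitzan2024, §5.5 (context only; the inequality is Fortuin–Kasteleyn–Ginibre / Harris–Kleitman)] -/
theorem fkg_powerset (E : Finset ι) (Φ Ψ : Finset ι → ℝ) (hΦ : Monotone Φ) (hΨ : Monotone Ψ) :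
    (∑ t ∈ E.powerset, Φ t) * (∑ t ∈ E.powerset, Ψ t) ≤ (2 ^ E.card : ℝ) * ∑ t ∈ E.powerset, Φ t * Ψ t := by
  have hcell : univ.filter (fun t : Finset ι => t ∩ Eᶜ = ∅) = E.powerset := by
    ext t
    simp only [Finset.mem_filter, Finset.mem_univ, true_and, Finset.mem_powerset]
    constructor
    · intro h i hi
      by_contra hiE
      have : i ∈ t ∩ Eᶜ := Finset.mem_inter.mpr ⟨hi, Finset.mem_compl.mpr hiE⟩
      rw [h] at this
      exact absurd this (Finset.notMem_empty i)
    · intro h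
      ext i
      simp only [Finset.mem_inter, Finset.mem_compl, Finset.notMem_empty, iff_false, not_and, not_not]
      exact fun hi => h hi
  have key := fkg_cell Eᶜ ∅ Φ Ψ hΦ hΨ
  rw [hcell, Finset.card_powerset] at key
  push_cast at key
  exact key

/-- Harris' inequality in two-colouring form on a sub-multigraph (the colourings `t ⊆ E`, complement `E ∖ t`): for monotone `Φ, Ψ`,
`0 ≤ Σ_{t ⊆ E} (Φ t − Φ (E∖t))(Ψ t − Ψ(E ∖ t))`.  (FKG on `E.powerset` applied to the monotone differences, whose sums vanish by the swap.)
[cite: KozmaNitzan2024, Questions 8–9 (§5.5 p. 36) (context)] -/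
theorem harris_twoColouring_powerset (E : Finset ι) (Φ Ψ : Finset ι → ℝ) (hΦ : Monotone Φ) (hΨ : Monotone Ψ) :
    0 ≤ ∑ t ∈ E.powerset, (Φ t - Φ (E \ t)) * (Ψ t - Ψ (E \ t)) := by
  -- monotone extensions of the differences to all of `Finset ι`
  set F : Finset ι → ℝ := fun t => Φ (t ∩ E) - Φ (E \ t) with hF
  set G : Finset ι → ℝ := fun t => Ψ (t ∩ E) - Ψ (E \ t) with hG
  have hFm : Monotone F := by
    intro a b hab
    simp only [hF]
    have h1 : Φ (a ∩ E) ≤ Φ (b ∩ E) := hΦ (Finset.inter_subset_inter_right hab)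
    have h2 : Φ (E \ b) ≤ Φ (E \ a) := hΦ (Finset.sdiff_subset_sdiff (le_refl E) hab)
    linarith
  have hGm : Monotone G := by
    intro a b hab
    simp only [hG]
    have h1 : Ψ (a ∩ E) ≤ Ψ (b ∩ E) := hΨ (Finset.inter_subset_inter_right hab)
    have h2 : Ψ (E \ b) ≤ Ψ (E \ a) := hΨ (Finset.sdiff_subset_sdiff (le_refl E) hab)
    linarith
  have key := fkg_powerset E F G hFm hGm
  have hFE : ∀ t ∈ E.powerset, F t = Φ t - Φ (E \ t) := fun t ht => by
    simp only [hF, Finset.inter_eq_left.mpr (Finset.mem_powerset.mp ht)]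
  have hGE : ∀ t ∈ E.powerset, G t = Ψ t - Ψ (E \ t) := fun t ht => by
    simp only [hG, Finset.inter_eq_left.mpr (Finset.mem_powerset.mp ht)]
  -- the sums of the differences vanish
  have hF0 : ∑ t ∈ E.powerset, F t = 0 := by
    rw [Finset.sum_congr rfl hFE, Finset.sum_sub_distrib, sum_powerset_sdiff E Φ, sub_self]
  have hFG : ∑ t ∈ E.powerset, F t * G t = ∑ t ∈ E.powerset, (Φ t - Φ (E \ t)) * (Ψ t - Ψ (E \ t)) :=
    Finset.sum_congr rfl fun t ht => by rw [hFE t ht, hGE t ht]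
  rw [hF0, zero_mul, hFG] at key
  have hpos : (0 : ℝ) < (2 ^ E.card : ℝ) := by positivity
  exact (mul_nonneg_iff_of_pos_left hpos).mp key

end sums

section sub
variable [DecidableEq ι]

open Classical in
/-- **Two-function off-cluster lemma on a sub-multigraph.**  For an edge set `E'`, a root `x`, an avoided set `A` and monotone `f ≤ f̃`, `g ≤ g̃`,
`0 ≤ Σ_{t ⊆ E' : A ∩ C_x(t) = ∅} (f(C_x t) − f̃(C_x(E'∖t)))·(g(C_x t) − g̃(C_x(E'∖t)))` — `offCluster_twoColouring_nonneg₂` for the multigraph with edge set `E'`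
(transported along `{i // i ∈ E'}` exactly as `offCluster_twoColouring_nonneg_sub`).  It is the `(1,0)` block of the series step of THEOREM SP.
[cite: KozmaNitzan2024, Questions 8–9 (§5.5 p. 36) (context)] -/
theorem offCluster_twoColouring_nonneg₂_sub (ends : ι → Sym2 V) (E' : Finset ι) (x : V) (A : Set V) (f f' g g' : Set V → ℝ)
    (hf : Monotone f) (hf' : Monotone f') (hg : Monotone g) (hg' : Monotone g')
    (hff' : ∀ W, f W ≤ f' W) (hgg' : ∀ W, g W ≤ g' W) :
    0 ≤ ∑ t ∈ E'.powerset.filter (fun t : Finset ι => ∀ a ∈ A, a ∉ openCluster (ends '' (↑t : Set ι)) x),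
      (f (openCluster (ends '' (↑t : Set ι)) x) - f' (openCluster (ends '' (↑(E' \ t) : Set ι)) x)) *
        (g (openCluster (ends '' (↑t : Set ι)) x) - g' (openCluster (ends '' (↑(E' \ t) : Set ι)) x)) := by
  set emb : {i // i ∈ E'} ↪ ι := Function.Embedding.subtype _ with hemb
  have key := offCluster_twoColouring_nonneg₂ (ends ∘ Subtype.val : {i // i ∈ E'} → Sym2 V) x A f f' g g' hf hf' hg hg' hff' hgg'
  have map_compl : ∀ t : Finset {i // i ∈ E'}, (tᶜ).map emb = E' \ t.map emb := by
    intro t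
    ext i
    simp only [Finset.mem_map, Finset.mem_compl, Finset.mem_sdiff, hemb, Function.Embedding.coe_subtype]
    constructor
    · rintro ⟨⟨j, hj⟩, hjt, rfl⟩
      exact ⟨hj, fun ⟨⟨k, hk⟩, hkt, hkj⟩ => hjt (by cases hkj; exact hkt)⟩
    · rintro ⟨hiE, hnot⟩
      exact ⟨⟨i, hiE⟩, fun hit => hnot ⟨⟨i, hiE⟩, hit, rfl⟩, rfl⟩
  have map_sub : ∀ t : Finset {i // i ∈ E'}, t.map emb ⊆ E' := by
    intro t i hi
    obtain ⟨⟨j, hj⟩, _, rfl⟩ := Finset.mem_map.mp hi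
    exact hj
  refine key.trans_eq ?_
  refine Finset.sum_bij' (fun t _ => t.map emb) (fun t _ => t.subtype (· ∈ E')) ?_ ?_ ?_ ?_ ?_
  · intro t ht
    rw [Finset.mem_filter] at ht ⊢
    refine ⟨Finset.mem_powerset.mpr (map_sub t), ?_⟩
    rw [← image_map_subtype]; exact ht.2
  · intro t ht
    rw [Finset.mem_filter] at ht ⊢
    refine ⟨Finset.mem_univ _, ?_⟩
    have hsub : t ⊆ E' := Finset.mem_powerset.mp ht.1
    rw [image_map_subtype, Finset.subtype_map_of_mem (fun i hi => hsub hi)]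
    exact ht.2
  · intro t _
    ext ⟨i, hi⟩
    rw [Finset.mem_subtype, Finset.mem_map]
    constructor
    · rintro ⟨⟨j, hj⟩, hjt, hji⟩
      have hji' : j = i := by simpa [hemb] using hji
      subst hji'
      exact hjt
    · intro h
      exact ⟨⟨i, hi⟩, h, by simp [hemb]⟩
  · intro t ht
    have hsub : t ⊆ E' := Finset.mem_powerset.mp (Finset.mem_filter.mp ht).1
    exact Finset.subtype_map_of_mem (fun i hi => hsub hi)
  · intro t _
    rw [image_map_subtype, image_map_subtype ends E' (tᶜ), map_compl]

end sub

end Coefficientwise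

end Summit.CriticalPhenomena.PercolationContinuityZ3.Theorems
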